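import Summits.QuantumFields.YangMills.Theorems.NPointIsotropy.Negative.NPointRegularJunk
import Summits.QuantumFields.YangMills.Theorems.CurvatureBoostCovariance.Negative.Unbundled
import Summits.QuantumFields.YangMills.Theorems.PencilRigidityNPointIsotropyMopupHelpers

/-!
# `PencilRigidity.NPointIsotropy`, line `quarter-turn-corner-operator`: frame transport (stub B2)

Stub `stub_frameTransport` of crux `stmt-QuantumFields-11686`
(`Summit.QuantumFields.YangMills.Theses.PencilRigidity.NPointIsotropy`), line `quarter-turn-corner-operator`
(lead-1, gen 1), proved over the tree as it is (tree objects `SchwingerFamily.toLabelled`, `linActMulti`,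
`permTest`, `IsOffDiagonal`, `NPointRegular` only; nothing is posited, no named fact is used).

Informal statement. Let `S₁` be a one-species Schwinger family on `ℝ⁴` and `R` a linear isometry of `ℝ⁴`; write
`S_R := n ↦ 𝔖ₙ ∘ (R · )` for the pulled-back family (`(R·F)(x) = F(R⁻¹x₁, …, R⁻¹xₙ)`, the tree's `linActMulti`).
* (E3) If `S₁` is symmetric on `⁰𝒮` (`𝔖ₙ(F^π) = 𝔖ₙ(F)` for off-diagonal `F`), so is `S_R`.
* (function residual) If every `𝔖ₙ|⁰𝒮` is integration against a function `Wₙ` (`NPointRegular S₁`), then every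
  `(S_R)ₙ|⁰𝒮` is integration against `x ↦ Wₙ(Rx₁, …, Rxₙ)`.

Proof. (E3) The diagonal action commutes with permutations of the arguments,
`R·(F^π) = (R·F)^π` (both are `x ↦ F(R⁻¹x_{π 1}, …, R⁻¹x_{π n})`), and `⁰𝒮` is `R·`-stable
(`isOffDiagonal_linActMulti`), so `𝔖ₙ(R·F^π) = 𝔖ₙ((R·F)^π) = 𝔖ₙ(R·F)`. (Residual) For off-diagonal `F`, `R·F` is
off-diagonal, so `𝔖ₙ(R·F) = ∫ Wₙ(y) F(R⁻¹y) dy = ∫ Wₙ(Rx) F(x) dx` by the change of variables `y = Rx`, which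
preserves Lebesgue measure on `(ℝ⁴)ⁿ` (`Mopup.measurePreserving_diag`, `Mopup.integral_mul_linActMulti`); the
same change of variables transports integrability (`MeasurePreserving.integrable_comp_of_integrable`).
References: folklore (K. Osterwalder, R. Schrader, Comm. Math. Phys. 31 (1973) §4.2 for the change-of-variables
pattern).
-/

noncomputable section

-- Mathlib's `SimplexCategory` instance `Fintype (Fin (x.len + 1))` matches `Fintype (Fin 4)` (tree-known workaround).
attribute [-instance] SimplexCategory.instFintypeToTypeOrderHomFinHAddNatLenOfNat

namespace Summit.QuantumFields.YangMills.Theorems.NPointIsotropy.QuarterTurnCornerOperator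

open scoped SchwartzMap
open MeasureTheory
open Literature.MathematicalPhysics.QuantumLattice Literature.MathematicalPhysics.AQFT
open Summit.QuantumFields.YangMills.Theorems.NPointIsotropy.Negative (E4 NPointRegular)
open Summit.QuantumFields.YangMills.Theorems.CurvatureBoostCovariance.Negative (isOffDiagonal_linActMulti)
open Summit.QuantumFields.YangMills.Theorems.NPointIsotropy.ComplexRotationBandlimit
  (Mopup.measurePreserving_diag Mopup.integral_mul_linActMulti)

namespace FrameTransport

variable {n : ℕ}

/-- The diagonal isometry action commutes with permutations of the arguments:
`R·(F^π) = (R·F)^π`, both being `x ↦ F(R⁻¹x_{π 1}, …, R⁻¹x_{π n})`. [folklore] -/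
theorem linActMulti_permTest (R : E4 ≃ₗᵢ[ℝ] E4) (π : Equiv.Perm (Fin n)) (F : 𝓢((Fin n → E4), ℂ)) :
    linActMulti R (permTest π F) = permTest π (linActMulti R F) := by
  ext x
  simp [linActMulti_apply, permTest_apply, Function.comp_def]

/-- **E3 transports to the pull-back.** If `S₁` is symmetric on `⁰𝒮`, so is `n ↦ 𝔖ₙ ∘ (R · )` for every linear
isometry `R` (the diagonal action commutes with permutations and preserves `⁰𝒮`). [folklore] -/
theorem isSymmetric_pullBack (S₁ : SchwingerFamily E4) (R : E4 ≃ₗᵢ[ℝ] E4)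
    (hsym : S₁.toLabelled.IsSymmetric) :
    (SchwingerFamily.toLabelled fun n => (S₁ n).comp (linActMulti R)).IsSymmetric := by
  intro n k π F hF
  show S₁ n (linActMulti R (permTest π F)) = S₁ n (linActMulti R F)
  rw [linActMulti_permTest]
  exact hsym n k π _ (isOffDiagonal_linActMulti hF R)

/-- **The function residual transports to the pull-back.** If `𝔖ₙ|⁰𝒮 = ∫ Wₙ ·` with `Wₙ·F` integrable for
off-diagonal `F`, then `(𝔖ₙ ∘ (R · ))|⁰𝒮 = ∫ (Wₙ ∘ R) ·` with the same integrability, where `R` acts diagonally: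
`𝔖ₙ(R·F) = ∫ Wₙ(y) F(R⁻¹y) dy = ∫ Wₙ(Rx) F(x) dx` (Lebesgue measure on `(ℝ⁴)ⁿ` is `R`-invariant). [folklore] -/
theorem nPointRegular_pullBack (S₁ : SchwingerFamily E4) (R : E4 ≃ₗᵢ[ℝ] E4) (hreg : NPointRegular S₁) :
    NPointRegular fun n => (S₁ n).comp (linActMulti R) := by
  intro n
  obtain ⟨W, hW⟩ := hreg n
  refine ⟨fun x => W fun k => R (x k), fun F hF => ?_⟩
  obtain ⟨h1, h2⟩ := hW _ (isOffDiagonal_linActMulti hF R)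
  have hcomp : (fun x : Fin n → E4 => W (fun k => R (x k)) * F x) =
      (fun y => W y * linActMulti R F y) ∘ fun (x : Fin n → E4) (k : Fin n) => R (x k) := by
    funext x
    simp [linActMulti_apply]
  refine ⟨?_, ?_⟩
  · rw [hcomp]
    exact (Mopup.measurePreserving_diag R).integrable_comp_of_integrable h1
  · show S₁ n (linActMulti R F) = _
    rw [h2]
    exact (Mopup.integral_mul_linActMulti R W F).symm

end FrameTransport

/-- **Stub B2 — frame transport of E3 and of the function residual.** For every linear isometry `R`, the
pulled-back family `n ↦ 𝔖ₙ ∘ (R · )` inherits E3 on `⁰𝒮` (`permTest` commutes with `linActMulti`; `⁰𝒮` is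
`linActMulti`-stable) and the function residual `NPointRegular` (`Wₙ ↦ Wₙ ∘ (R · )` coordinatewise; Lebesgue
measure on `(ℝ⁴)ⁿ` is `R`-invariant). Registered stub of line `quarter-turn-corner-operator` of crux
`stmt-QuantumFields-11686`, stated byte-for-byte as registered. [folklore] -/
theorem stub_frameTransport :
    open Literature.MathematicalPhysics.QuantumLattice Literature.MathematicalPhysics.AQFT
      Summit.QuantumFields.YangMills.Theorems.NPointIsotropy.Negative in
    ∀ (S₁ : SchwingerFamily E4) (R : E4 ≃ₗᵢ[ℝ] E4), S₁.toLabelled.IsSymmetric → NPointRegular S₁ →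
      (SchwingerFamily.toLabelled (fun n => (S₁ n).comp (linActMulti R))).IsSymmetric ∧
        NPointRegular (fun n => (S₁ n).comp (linActMulti R)) := by
  intro S₁ R hsym hreg
  exact ⟨FrameTransport.isSymmetric_pullBack S₁ R hsym, FrameTransport.nPointRegular_pullBack S₁ R hreg⟩

end Summit.QuantumFields.YangMills.Theorems.NPointIsotropy.QuarterTurnCornerOperator

end
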